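import Mathlib.Combinatorics.SetFamily.FourFunctions
import Mathlib.Algebra.BigOperators.Ring.Finset
import Mathlib.Data.Real.Basic
import Mathlib.Data.Fintype.Prod
import Mathlib.Order.UpperLower.Basic
import Mathlib.Tactic.Linarith
import Mathlib.Tactic.Positivity
import Mathlib.Tactic.Ring
import HarnessLib

/-!
# Twisted Ahlswede–Daykin inequalities: the pair lattice `L × Lᵒᵈ` with the swap involution, and the Boolean lattice with complementation

Support file for the master-family `F`-inequality programme (`prim-master-conj` gen 24; `--supports stmt-CriticalPhenomena-4575`;
memo `run/shared/lean/prim/prim-l12/prim-master-conj/POINTWISE.md` §25).  No definition, no `sorry`, standard axioms.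

Background.  The conjectured inequality `F(A,B;G) = μ(Ω)μ(A∩B∩G) − μ(A∩G)μ(B∩G) − μ(G)μ((A∩B)∖G) ≥ 0` (increasing `A, B, G`; product
or, conjecturally, any log-supermodular `μ`, §25 (V1)) is the instance `(L × Lᵒᵖ, swap, μ⊗μ)` of a general antipodal inequality on a finite
distributive lattice carrying an antitone involution and an invariant log-supermodular weight (§25 (V7)).  The four-functions theorem of
Ahlswede–Daykin on such a structure, applied to the pair `(X, σZ)`, yields "twisted" two-set inequalities whose one-set case is a weighted
Marica–Schönheim inequality; these certify the `G = Ω` case of `F` (= FKG) in one line, are tight on the `A = B = Ω` case, and certify all but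
96 of the 642,036 deficit triples of `{0,1}⁴` at depth ≤ 2 (§25 (V8)).  This file puts the two basic tools in the kernel, derived from Mathlib's
`four_functions_theorem`:

* `twisted_four_functions_pairs` — for a finite distributive lattice `α`, a weight `w ≥ 0` with the FKG lattice condition
  `w a * w b ≤ w (a ⊓ b) * w (a ⊔ b)`, and `X Z : Finset (α × α)`:
  `(∑_{X} w⊗w) * (∑_{Z} w⊗w) ≤ (∑_{X ⋄ Z} w⊗w) * (∑_{Z ⋄ X} w⊗w)`, where `X ⋄ Z = image₂ (fun m n ↦ (m.1 ⊓ n.2, m.2 ⊔ n.1)) X Z`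
  (the meet of `X` with the swap of `Z` in the twisted order `(x,y) ≤ (x',y') ⟺ x ≤ x' ∧ y ≥ y'`);
* `twisted_marica_schonheim_pairs` — the case `Z = X`: `∑_{X} w⊗w ≤ ∑_{X ⋄ X} w⊗w`;
* `fkg_upperSet_of_latticeCondition` — COROLLARY (demonstration that the tool subsumes FKG for events): for upper sets `A, B`,
  `(∑_{A} w)(∑_{B} w) ≤ (∑_{univ} w)(∑_{A ∩ B} w)`, via `X = A ×ˢ B`, `X ⋄ X ⊆ univ ×ˢ (A ∩ B)`;
* `twisted_four_functions_compl`, `weighted_marica_schonheim` — the Boolean habitat `(Finset κ, ᶜ, ω)` with a complement-symmetric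
  log-supermodular weight `ω`: `(∑_X ω)(∑_Z ω) ≤ (∑_{X \\ Z} ω)(∑_{Z \\ X} ω)` and `∑_X ω ≤ ∑_{X \\ X} ω`
  (`X \\ Z = {x \ z}`; `ω ≡ 1` is Mathlib's `Finset.card_le_card_diffs`).

HONEST FRAMING: elementary corollaries of the four-functions theorem (new only as packaged tools with weights/involution); `F ≥ 0` itself
remains OPEN. [this work]
-/

namespace Summit.CriticalPhenomena.PercolationContinuityZ3.Theorems

namespace TwistedAD

open Finset OrderDual
open scoped FinsetFamily

/-! ### 1. The pair lattice `α × αᵒᵈ` with the swap involution -/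

section Transfer

variable {α : Type*}

/-- Transfer map `α × α → α × αᵒᵈ`, `(x, y) ↦ (x, toDual y)` (injective). [this work] -/
private theorem phi_injective :
    Function.Injective (fun m : α × α => ((m.1, toDual m.2) : α × αᵒᵈ)) := by
  intro m n h
  simp only [Prod.mk.injEq, toDual_inj] at h
  exact Prod.ext h.1 h.2

/-- Transfer map `α × α → α × αᵒᵈ`, `(x, y) ↦ (y, toDual x)` (the swap followed by the transfer; injective). [this work] -/
private theorem psi_injective :
    Function.Injective (fun m : α × α => ((m.2, toDual m.1) : α × αᵒᵈ)) := by
  intro m n h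
  simp only [Prod.mk.injEq, toDual_inj] at h
  exact Prod.ext h.2 h.1

end Transfer

section Pairs

variable {α : Type*} [DistribLattice α] [DecidableEq α]

omit [DecidableEq α] in
/-- The product weight `(x, y*) ↦ w x * w (ofDual y*)` satisfies the FKG lattice condition on `α × αᵒᵈ` when `w` does on `α`
(the condition for `w` is symmetric under exchanging `⊓` and `⊔`, so it also holds on `αᵒᵈ`). [this work] -/
private theorem pairWeight_latticeCondition (w : α → ℝ) (hw₀ : ∀ a, 0 ≤ w a)
    (hw : ∀ a b, w a * w b ≤ w (a ⊓ b) * w (a ⊔ b)) (p q : α × αᵒᵈ) :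
    (w p.1 * w (ofDual p.2)) * (w q.1 * w (ofDual q.2))
      ≤ (w (p ⊓ q).1 * w (ofDual (p ⊓ q).2)) * (w (p ⊔ q).1 * w (ofDual (p ⊔ q).2)) := by
  obtain ⟨p1, p2⟩ := p
  obtain ⟨q1, q2⟩ := q
  simp only [Prod.mk_inf_mk, Prod.mk_sup_mk, _root_.ofDual_inf, _root_.ofDual_sup]
  have h1 : w p1 * w q1 ≤ w (p1 ⊓ q1) * w (p1 ⊔ q1) := hw p1 q1
  have h2 : w (ofDual p2) * w (ofDual q2) ≤ w (ofDual p2 ⊓ ofDual q2) * w (ofDual p2 ⊔ ofDual q2) :=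
    hw (ofDual p2) (ofDual q2)
  have e1 : w p1 * w (ofDual p2) * (w q1 * w (ofDual q2)) = (w p1 * w q1) * (w (ofDual p2) * w (ofDual q2)) := by ring
  have e2 : w (p1 ⊓ q1) * w (ofDual p2 ⊔ ofDual q2) * (w (p1 ⊔ q1) * w (ofDual p2 ⊓ ofDual q2))
      = (w (p1 ⊓ q1) * w (p1 ⊔ q1)) * (w (ofDual p2 ⊓ ofDual q2) * w (ofDual p2 ⊔ ofDual q2)) := by ring
  rw [e1, e2]
  exact mul_le_mul h1 h2 (mul_nonneg (hw₀ _) (hw₀ _)) (mul_nonneg (hw₀ _) (hw₀ _))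

/-- **Twisted four-functions inequality on pairs.**  Let `α` be a finite distributive lattice and `w : α → ℝ` a nonnegative weight
satisfying the FKG lattice condition `w a * w b ≤ w (a ⊓ b) * w (a ⊔ b)`.  For `X Z : Finset (α × α)` put
`X ⋄ Z := image₂ (fun m n ↦ (m.1 ⊓ n.2, m.2 ⊔ n.1)) X Z`.  Then
`(∑_{m ∈ X} w m.1 * w m.2) * (∑_{m ∈ Z} w m.1 * w m.2) ≤ (∑_{m ∈ X ⋄ Z} w m.1 * w m.2) * (∑_{m ∈ Z ⋄ X} w m.1 * w m.2)`.
Proof: Ahlswede–Daykin (`four_functions_theorem`) on the distributive lattice `α × αᵒᵈ` (order `(x,y) ≤ (x',y') ⟺ x ≤ x', y ≥ y'`) with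
all four functions equal to the product weight and the sets `X` and `swap Z`; the swap is an antitone involution preserving the product
weight, so `X ⊓ swap Z = X ⋄ Z` and `X ⊔ swap Z = swap (Z ⋄ X)`. [this work; Ahlswede–Daykin 1978 via Mathlib] -/
theorem twisted_four_functions_pairs (w : α → ℝ) (hw₀ : ∀ a, 0 ≤ w a)
    (hw : ∀ a b, w a * w b ≤ w (a ⊓ b) * w (a ⊔ b)) (X Z : Finset (α × α)) :
    (∑ m ∈ X, w m.1 * w m.2) * (∑ m ∈ Z, w m.1 * w m.2)
      ≤ (∑ m ∈ image₂ (fun m n => (m.1 ⊓ n.2, m.2 ⊔ n.1)) X Z, w m.1 * w m.2)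
        * (∑ m ∈ image₂ (fun m n => (m.1 ⊓ n.2, m.2 ⊔ n.1)) Z X, w m.1 * w m.2) := by
  -- the product weight on `α × αᵒᵈ`
  set pw : α × αᵒᵈ → ℝ := fun p => w p.1 * w (ofDual p.2) with hpw
  have hpw₀ : 0 ≤ pw := fun p => mul_nonneg (hw₀ _) (hw₀ _)
  have hlat : ∀ p q, pw p * pw q ≤ pw (p ⊓ q) * pw (p ⊔ q) := fun p q =>
    pairWeight_latticeCondition w hw₀ hw p q
  -- transfer maps
  let φ : α × α → α × αᵒᵈ := fun m => (m.1, toDual m.2)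
  let ψ : α × α → α × αᵒᵈ := fun m => (m.2, toDual m.1)
  have hφ : Function.Injective φ := phi_injective
  have hψ : Function.Injective ψ := psi_injective
  have key := four_functions_theorem pw pw pw pw hpw₀ hpw₀ hpw₀ hpw₀ hlat (X.image φ) (Z.image ψ)
  -- identify the four sums
  have s1 : ∑ p ∈ X.image φ, pw p = ∑ m ∈ X, w m.1 * w m.2 := by
    rw [sum_image (fun m _ n _ h => hφ h)]
    refine sum_congr rfl fun m _ => ?_
    simp only [hpw, φ, ofDual_toDual]
  have s2 : ∑ p ∈ Z.image ψ, pw p = ∑ m ∈ Z, w m.1 * w m.2 := by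
    rw [sum_image (fun m _ n _ h => hψ h)]
    refine sum_congr rfl fun m _ => ?_
    simp only [hpw, ψ, ofDual_toDual]
    ring
  have e3 : X.image φ ⊼ Z.image ψ = (image₂ (fun m n => (m.1 ⊓ n.2, m.2 ⊔ n.1)) X Z).image φ := by
    show image₂ (· ⊓ ·) (X.image φ) (Z.image ψ) = _
    rw [image₂_image_left, image₂_image_right, image_image₂]
    refine image₂_congr fun m _ n _ => ?_
    show ((m.1, toDual m.2) : α × αᵒᵈ) ⊓ (n.2, toDual n.1) = ((m.1 ⊓ n.2), toDual (m.2 ⊔ n.1))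
    rw [Prod.mk_inf_mk, _root_.toDual_sup]
  have e4 : X.image φ ⊻ Z.image ψ = (image₂ (fun m n => (m.1 ⊓ n.2, m.2 ⊔ n.1)) Z X).image ψ := by
    show image₂ (· ⊔ ·) (X.image φ) (Z.image ψ) = _
    rw [image₂_image_left, image₂_image_right, image_image₂, image₂_swap]
    refine image₂_congr fun n _ m _ => ?_
    show ((m.1, toDual m.2) : α × αᵒᵈ) ⊔ (n.2, toDual n.1) = ((n.2 ⊔ m.1), toDual (n.1 ⊓ m.2))
    rw [Prod.mk_sup_mk, _root_.toDual_inf, sup_comm m.1, sup_comm (toDual m.2)]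
  have s3 : ∑ p ∈ X.image φ ⊼ Z.image ψ, pw p
      = ∑ m ∈ image₂ (fun m n => (m.1 ⊓ n.2, m.2 ⊔ n.1)) X Z, w m.1 * w m.2 := by
    rw [e3, sum_image (fun m _ n _ h => hφ h)]
    refine sum_congr rfl fun m _ => ?_
    simp only [hpw, φ, ofDual_toDual]
  have s4 : ∑ p ∈ X.image φ ⊻ Z.image ψ, pw p
      = ∑ m ∈ image₂ (fun m n => (m.1 ⊓ n.2, m.2 ⊔ n.1)) Z X, w m.1 * w m.2 := by
    rw [e4, sum_image (fun m _ n _ h => hψ h)]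
    refine sum_congr rfl fun m _ => ?_
    simp only [hpw, ψ, ofDual_toDual]
    ring
  rw [s1, s2, s3, s4] at key
  exact key

/-- **Twisted Marica–Schönheim inequality on pairs** (`Z = X` in `twisted_four_functions_pairs`): with
`X ⋄ X = image₂ (fun m n ↦ (m.1 ⊓ n.2, m.2 ⊔ n.1)) X X`, `∑_{m ∈ X} w m.1 * w m.2 ≤ ∑_{m ∈ X ⋄ X} w m.1 * w m.2`. [this work] -/
theorem twisted_marica_schonheim_pairs (w : α → ℝ) (hw₀ : ∀ a, 0 ≤ w a)
    (hw : ∀ a b, w a * w b ≤ w (a ⊓ b) * w (a ⊔ b)) (X : Finset (α × α)) :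
    ∑ m ∈ X, w m.1 * w m.2 ≤ ∑ m ∈ image₂ (fun m n => (m.1 ⊓ n.2, m.2 ⊔ n.1)) X X, w m.1 * w m.2 := by
  have h := twisted_four_functions_pairs w hw₀ hw X X
  have ha : 0 ≤ ∑ m ∈ X, w m.1 * w m.2 := sum_nonneg fun m _ => mul_nonneg (hw₀ _) (hw₀ _)
  have hb : 0 ≤ ∑ m ∈ image₂ (fun m n => (m.1 ⊓ n.2, m.2 ⊔ n.1)) X X, w m.1 * w m.2 :=
    sum_nonneg fun m _ => mul_nonneg (hw₀ _) (hw₀ _)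
  exact (mul_self_le_mul_self_iff ha hb).2 h

/-- **FKG for events from the twisted Marica–Schönheim inequality** (a demonstration; `Finset` form of Mathlib's `fkg`).  For a finite
distributive lattice `α`, a nonnegative weight `w` with the FKG lattice condition, and upper sets `A, B`:
`(∑_{A} w) * (∑_{B} w) ≤ (∑_{univ} w) * (∑_{A ∩ B} w)`.  Proof: `X := A ×ˢ B` has `∑_X w⊗w = (∑_A w)(∑_B w)` and
`X ⋄ X ⊆ univ ×ˢ (A ∩ B)` because `m.2 ⊔ n.1 ∈ A ∩ B` for `m.2 ∈ B`, `n.1 ∈ A`. [this work; FKG 1971] -/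
theorem fkg_upperSet_of_latticeCondition [Fintype α] (w : α → ℝ) (hw₀ : ∀ a, 0 ≤ w a)
    (hw : ∀ a b, w a * w b ≤ w (a ⊓ b) * w (a ⊔ b)) (A B : Finset α)
    (hA : IsUpperSet (A : Set α)) (hB : IsUpperSet (B : Set α)) :
    (∑ a ∈ A, w a) * (∑ b ∈ B, w b) ≤ (∑ a, w a) * (∑ c ∈ A ∩ B, w c) := by
  have h := twisted_marica_schonheim_pairs w hw₀ hw (A ×ˢ B)
  rw [sum_product, ← sum_mul_sum] at h
  -- `h : (∑ A w) * (∑ B w) ≤ ∑_{X ⋄ X} w⊗w`; bound the right side by the sum over `univ ×ˢ (A ∩ B)`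
  have hsub : image₂ (fun m n : α × α => (m.1 ⊓ n.2, m.2 ⊔ n.1)) (A ×ˢ B) (A ×ˢ B) ⊆ univ ×ˢ (A ∩ B) := by
    intro p hp
    rw [mem_image₂] at hp
    obtain ⟨m, hm, n, hn, rfl⟩ := hp
    rw [mem_product] at hm hn
    simp only [mem_product, mem_univ, true_and, mem_inter]
    exact ⟨hA (le_sup_right : n.1 ≤ m.2 ⊔ n.1) (by exact_mod_cast hn.1),
      hB (le_sup_left : m.2 ≤ m.2 ⊔ n.1) (by exact_mod_cast hm.2)⟩
  calc (∑ a ∈ A, w a) * (∑ b ∈ B, w b)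
      ≤ ∑ m ∈ image₂ (fun m n : α × α => (m.1 ⊓ n.2, m.2 ⊔ n.1)) (A ×ˢ B) (A ×ˢ B), w m.1 * w m.2 := h
    _ ≤ ∑ m ∈ univ ×ˢ (A ∩ B), w m.1 * w m.2 :=
        sum_le_sum_of_subset_of_nonneg hsub fun m _ _ => mul_nonneg (hw₀ _) (hw₀ _)
    _ = (∑ a, w a) * (∑ c ∈ A ∩ B, w c) := by
        rw [sum_product, sum_mul_sum]

end Pairs

/-! ### 2. The Boolean lattice `Finset κ` with complementation -/

section Compl

variable {κ : Type*} [Fintype κ] [DecidableEq κ]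

/-- **Twisted four-functions inequality on the cube.**  For a nonnegative weight `ω` on `Finset κ` (the cube `{0,1}^κ`) which satisfies the
FKG lattice condition and is invariant under complementation, and `X Z : Finset (Finset κ)`:
`(∑_X ω)(∑_Z ω) ≤ (∑_{X \\ Z} ω)(∑_{Z \\ X} ω)` where `X \\ Z = {x \ z : x ∈ X, z ∈ Z}`.  Proof: Ahlswede–Daykin for the pair `(X, Zᶜˢ)`,
`X ⊼ Zᶜˢ = X \\ Z`, `X ⊻ Zᶜˢ = (Z \\ X)ᶜˢ`, and `∑_{Sᶜˢ} ω = ∑_S ω`. [this work; `ω ≡ 1`: Mathlib `Finset.le_card_diffs_mul_card_diffs`] -/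
theorem twisted_four_functions_compl (ω : Finset κ → ℝ) (hω₀ : ∀ s, 0 ≤ ω s)
    (hω : ∀ s t, ω s * ω t ≤ ω (s ⊓ t) * ω (s ⊔ t)) (hsym : ∀ s, ω sᶜ = ω s) (X Z : Finset (Finset κ)) :
    (∑ s ∈ X, ω s) * (∑ s ∈ Z, ω s) ≤ (∑ s ∈ X \\ Z, ω s) * (∑ s ∈ Z \\ X, ω s) := by
  have key := four_functions_theorem ω ω ω ω hω₀ hω₀ hω₀ hω₀ hω (X) (Zᶜˢ)
  have hc : ∀ S : Finset (Finset κ), ∑ s ∈ Sᶜˢ, ω s = ∑ s ∈ S, ω s := by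
    intro S
    rw [← image_compl, sum_image (fun s _ t _ h => compl_injective h)]
    exact sum_congr rfl fun s _ => hsym s
  rw [hc Z, infs_compls_eq_diffs] at key
  have e : X ⊻ Zᶜˢ = (Z \\ X)ᶜˢ := by
    rw [← compls_infs_eq_diffs, compls_infs, compls_compls]
  rw [e, hc] at key
  exact key

/-- **Weighted Marica–Schönheim inequality.**  For a nonnegative, complement-invariant weight `ω` on `Finset κ` satisfying the FKG lattice
condition and any `X : Finset (Finset κ)`: `∑_X ω ≤ ∑_{X \\ X} ω`. [this work; `ω ≡ 1`: Marica–Schönheim 1969, Mathlib `Finset.card_le_card_diffs`] -/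
theorem weighted_marica_schonheim (ω : Finset κ → ℝ) (hω₀ : ∀ s, 0 ≤ ω s)
    (hω : ∀ s t, ω s * ω t ≤ ω (s ⊓ t) * ω (s ⊔ t)) (hsym : ∀ s, ω sᶜ = ω s) (X : Finset (Finset κ)) :
    ∑ s ∈ X, ω s ≤ ∑ s ∈ X \\ X, ω s := by
  have h := twisted_four_functions_compl ω hω₀ hω hsym X X
  have ha : 0 ≤ ∑ s ∈ X, ω s := sum_nonneg fun s _ => hω₀ s
  have hb : 0 ≤ ∑ s ∈ X \\ X, ω s := sum_nonneg fun s _ => hω₀ s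
  exact (mul_self_le_mul_self_iff ha hb).2 h

end Compl

end TwistedAD

end Summit.CriticalPhenomena.PercolationContinuityZ3.Theorems
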